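import Summits.QuantumFields.YangMills.Theorems.ForcedResponseSkewnessRunningCouplingCeilingOfFemto
import Summits.QuantumFields.YangMills.Theorems.ForcedResponseSkewnessFemtoOfFBL6
import HarnessLib

/-!
# Route `ForcedResponseSkewness`, crux `RunningCouplingCeiling` (stmt-QuantumFields-24275): the crux BY NAME from the route's SHARED
# femto engine stub `FBL6PinnedSigR` and ONE femto asymptotic-freedom statement (the femto log two-point law)

Helper file (`--supports stmt-QuantumFields-24275`) of the width prover `ym-line-frs-p3` (g5); by-name corollaries of
`…RunningCouplingCeilingOfFemto.lean` (p607517) for the v3 skeleton of line «pointwise-log-ceiling-r» (lead `ym-line-frs-p1` g3: stubs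
`stub_fbl6Pinned : FBL6PinnedSigR` — the plane-resolved frozen-boundary femto law along the pinned unit, the SAME stub as on the
deciding crux 24869 — and `stub_logCeiling : LogCeilingSigR`), using the lead's `Femto.fblPinnedSigR_of_fbl6` /
`Femto.scaleFreeLocalPinnedSigR_of_fbl6` (p607908):

* `logCeilingSigR_of_fbl6_femtoLog` — `FBL6PinnedSigR →` (femto log two-point law, pinned; INLINE hypothesis) `→ LogCeilingSigR`: the registered
  `stub_logCeiling` is REDUCED to one femto AF statement given the shared engine stub;
* `runningCouplingCeiling_of_fbl6_femtoLog` — `FBL6PinnedSigR →` (femto log two-point law, pinned) `→ RunningCouplingCeiling` BY NAME, i.e. the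
  candidate v4 composition `RunningCouplingCeiling_holds := runningCouplingCeiling_of_fbl6_femtoLog stub_fbl6Pinned stub_femtoLog`.

The femto log two-point law (text = the `hLog` binder below, proposed as `FemtoLogSigR` for the Defs if the lead adopts it): on every femto
cube (`b·a(β) ≤ ℓ₂`), for EVERY exterior, pairs with `n₀ ≤ ‖y−x‖` at collar depth `K(s)‖y−x‖ ≤ depth` (`s = ‖y−x‖·a(β)`, `K ≥ 1`,
`s·K(s) → 0`) have `‖y−x‖⁸ |kerCov_η(dens x, dens y)| ≤ C₂/log²(1/s)` — the upper clause of the record's `FC2` with the asymptotic-freedom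
shape; an exterior flux background `𝔅 ≍ depth⁻²` contaminates `‖y−x‖⁸·kerCov` by `≍ ḡ²(s)/K(s)⁴`, so the law is consistent at RG-improved one
loop with `K(s) ≍ log^{1/4}(1/s)` (allowed).  No summit is proved by any of this: conditional rung line (leaf R2a `BalabanLadder.NT`);
`stub_logCeiling` is reduced, not proved; the Yang–Mills mass gap is NOT proved.
-/

set_option autoImplicit false

noncomputable section

namespace Summit.QuantumFields.YangMills.Cruxes.RunningCouplingCeiling.Pointwise

open scoped SchwartzMap
open MeasureTheory Filter Topology
open Literature.MathematicalPhysics.QuantumFieldTheory Literature.MathematicalPhysics.QuantumLattice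
open Literature.Probability.LatticeModels
open Summit.QuantumFields.YangMills.Cruxes.OSLegsFromFemtoAndGap.DlrCollarTransfer
open Summit.QuantumFields.YangMills.Cruxes.ResponseLocalisation.Birth (FBL6PinnedSigR)
open Summit.QuantumFields.YangMills.Cruxes.ResponseLocalisation.Femto (fblPinnedSigR_of_fbl6 scaleFreeLocalPinnedSigR_of_fbl6)
open Summit.QuantumFields.YangMills.Theses.ForcedResponseSkewness

/-- **`stub_logCeiling` from the shared engine stub and the femto log two-point law**: `FBL6PinnedSigR` (the route's shared E0′ stub)
and the femto log two-point law along the pinned unit imply the registered `LogCeilingSigR`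
(`logCeilingSigR_of_femto` with `scaleFreeLocalPinnedSigR_of_fbl6`, `fblPinnedSigR_of_fbl6`). [folklore] -/
theorem logCeilingSigR_of_fbl6_femtoLog (h6 : FBL6PinnedSigR)
    (hLog : ∀ (G : Type) [Group G] [TopologicalSpace G] [IsTopologicalGroup G] [CompactSpace G],
      IsCompactSimpleLieGroup G →
      letI : MeasurableSpace G := borel G
      haveI : BorelSpace G := ⟨rfl⟩
      ∀ (r : LatticeRep G) (a : ℝ → ℝ), (∀ β, 0 < a β) → Filter.Tendsto a Filter.atTop (nhds 0) →
        (∃ (v₀ : 𝓢(EuclideanSpace ℝ (Fin 4), ℝ)) (ε β₅ Λ₅ : ℝ), HasCompactSupport v₀ ∧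
          tsupport v₀ ⊆ {y : EuclideanSpace ℝ (Fin 4) | 0 < y 0} ∧ 0 < ε ∧
          ∀ β : ℝ, β₅ ≤ β → ∀ L : ℕ, Λ₅ ≤ a β * L → ε ≤ Q2 G r β L (a β) (thetaTest 4 v₀) v₀) →
        ∃ (ℓ₂ C₂ β₂ : ℝ) (K : ℝ → ℝ) (n₀ : ℕ), 0 < ℓ₂ ∧ (∀ s, 1 ≤ K s) ∧
          Filter.Tendsto (fun s : ℝ => s * K s) (nhdsWithin 0 (Set.Ioi 0)) (nhds 0) ∧
          ∀ β : ℝ, β₂ ≤ β → ∀ (c : Fin 4 → ℤ) (b : ℕ), (b : ℝ) * a β ≤ ℓ₂ →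
            ∀ (η : LGConfig 4 G) (x y : Fin 4 → ℤ), (n₀ : ℝ) ≤ ‖siteToE (y - x)‖ →
              K (‖siteToE (y - x)‖ * a β) * ‖siteToE (y - x)‖ ≤ (depth c b x : ℝ) →
              K (‖siteToE (y - x)‖ * a β) * ‖siteToE (y - x)‖ ≤ (depth c b y : ℝ) →
                ‖siteToE (y - x)‖ ^ 8 * |kerCov G r β c b η (dens G r x) (dens G r y)| ≤
                  C₂ / Real.log (1 / (‖siteToE (y - x)‖ * a β)) ^ 2) :
    LogCeilingSigR :=
  logCeilingSigR_of_femto (scaleFreeLocalPinnedSigR_of_fbl6 h6) (fblPinnedSigR_of_fbl6 h6) hLog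

/-- **`RunningCouplingCeiling` (stmt-QuantumFields-24275) BY NAME from `FBL6PinnedSigR` and the femto log two-point law** — the candidate
v4 composition of line «pointwise-log-ceiling-r»: `RunningCouplingCeiling_holds := runningCouplingCeiling_of_fbl6_femtoLog stub_fbl6Pinned
stub_femtoLog`. [folklore] -/
theorem runningCouplingCeiling_of_fbl6_femtoLog (h6 : FBL6PinnedSigR)
    (hLog : ∀ (G : Type) [Group G] [TopologicalSpace G] [IsTopologicalGroup G] [CompactSpace G],
      IsCompactSimpleLieGroup G →
      letI : MeasurableSpace G := borel G
      haveI : BorelSpace G := ⟨rfl⟩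
      ∀ (r : LatticeRep G) (a : ℝ → ℝ), (∀ β, 0 < a β) → Filter.Tendsto a Filter.atTop (nhds 0) →
        (∃ (v₀ : 𝓢(EuclideanSpace ℝ (Fin 4), ℝ)) (ε β₅ Λ₅ : ℝ), HasCompactSupport v₀ ∧
          tsupport v₀ ⊆ {y : EuclideanSpace ℝ (Fin 4) | 0 < y 0} ∧ 0 < ε ∧
          ∀ β : ℝ, β₅ ≤ β → ∀ L : ℕ, Λ₅ ≤ a β * L → ε ≤ Q2 G r β L (a β) (thetaTest 4 v₀) v₀) →
        ∃ (ℓ₂ C₂ β₂ : ℝ) (K : ℝ → ℝ) (n₀ : ℕ), 0 < ℓ₂ ∧ (∀ s, 1 ≤ K s) ∧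
          Filter.Tendsto (fun s : ℝ => s * K s) (nhdsWithin 0 (Set.Ioi 0)) (nhds 0) ∧
          ∀ β : ℝ, β₂ ≤ β → ∀ (c : Fin 4 → ℤ) (b : ℕ), (b : ℝ) * a β ≤ ℓ₂ →
            ∀ (η : LGConfig 4 G) (x y : Fin 4 → ℤ), (n₀ : ℝ) ≤ ‖siteToE (y - x)‖ →
              K (‖siteToE (y - x)‖ * a β) * ‖siteToE (y - x)‖ ≤ (depth c b x : ℝ) →
              K (‖siteToE (y - x)‖ * a β) * ‖siteToE (y - x)‖ ≤ (depth c b y : ℝ) →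
                ‖siteToE (y - x)‖ ^ 8 * |kerCov G r β c b η (dens G r x) (dens G r y)| ≤
                  C₂ / Real.log (1 / (‖siteToE (y - x)‖ * a β)) ^ 2) :
    RunningCouplingCeiling :=
  runningCouplingCeiling_of_femto (fblPinnedSigR_of_fbl6 h6) hLog

end Summit.QuantumFields.YangMills.Cruxes.RunningCouplingCeiling.Pointwise

end
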